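import Summits.Ventures.CertifiedManyBodySolver.Observables.PairLROTowerWitness
import Summits.Ventures.CertifiedManyBodySolver.Observables.PairLROOnePointCeilingTT
import Literature.MathematicalPhysics.QuantumLattice.PairFieldNormBounds
import HarnessLib

/-!
# The SHARP one-point ceiling: a certified one-point bound `M` gives `liminf_k u_k ≤ M²` (Koma–Tasaki tower)

HONEST FRAMING: first certified bounds on pairing observables; not a superconductivity verdict. Crew hubbard-obs
(D-0042), seat hubbard-obs-p1 (`prover-hubbard-obs-p1-g5-0`). Zero compute; no definition; no named fact; no `sorry`.

PairLROOnePointCeiling(TT) read a one-point variational bound (OP1) — `c − A + Σ_σ μ_σ(Re⟨ζ,N_σζ⟩/L² − ν)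
+ κ(u − Re⟨ζ,H_Lζ⟩/L²) ≤ −Re⟨ζ,Δ_gζ⟩/L²` for every unit `ζ` of every large torus — through the two-sector KHvdL
witness: `liminf u_k ≤ 2M²`, `M = −(c − A + (Σμ)(n/2 − ν))`. Reading the SAME bound through the Koma–Tasaki tower
witness (`exists_towerWitness`: `k + 1` charge sectors `(Δ†)^m ψ_L/‖·‖`, one-point amplitude `≥ (k/(k+1))ρ_L`,
`ρ_L² = c₀L⁴ − (k+1)C_γL²`, energy excess `O_k(1)`, fillings `N_L/2 + k/2`) gives `(k/(k+1))√c₀ ≤ M` for every `k`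
whenever `liminf u > c₀`; hence **`liminf_k u_k ≤ M²`** — the sharp constant of Koma–Tasaki 1994 Theorem 5,
WITHOUT their commuting-densities hypothesis: the model enters only through `‖Δ†φ‖, ‖[H^{tt'},Δ†]φ‖ ≤ C·L²‖φ‖`
(PairFieldNormBounds) and `|⟨φ,[Δ,Δ†]φ⟩| ≤ C_γL²‖φ‖²` (PairFieldCommutatorLocality).
* `tower_finite_step` — one torus; * **`liminf_pairFieldLRO_le_sq_of_onePoint_variational_bound_TT'`** — the
  ceiling `(c − A + (Σμ)(n/2 − ν))²` (any `t, t'`, `U ≥ 0`, `0 ≤ n < 2`, any `g`, `κ ≥ 0`, `e(t,t',U,n) ≤ u`).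
Consumers (orbit-state / certificate / leaf form): PairLROTowerCeilingCert.lean.
References: T. Koma, H. Tasaki, J. Stat. Phys. 76 (1994) 745, Theorem 5, §4 [KomaTasaki1994]; J. Wang et al.,
PRX 14 (2024) 031006, §III [WangEtAl2024]; D. J. Scalapino, Phys. Rep. 250 (1995) 329, §2 eq. (2.4) [Scalapino1995].
-/

noncomputable section

namespace Summit.Ventures.CertifiedManyBodySolver.Observables

open Matrix Complex Finset Literature.MathematicalPhysics.QuantumLattice Literature.Probability.LatticeModels
open Literature.MathematicalPhysics.QuantumLattice.HubbardWave0 ThermodynamicLimit Filter Topology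
open Literature.MathematicalPhysics.QuantumManyBody.StateRelaxation
open scoped ComplexOrder ComplexConjugate BigOperators

/-! ### §0  Scaling of form bounds from unit vectors to all vectors -/

/-- A quadratic-form bound on unit vectors scales to all vectors: `|Re⟨ψ,Xψ⟩| ≤ B` for unit `ψ` gives
`|Re⟨φ,Xφ⟩| ≤ B‖φ‖²` for every `φ`. [folklore] -/
theorem abs_re_quadForm_le_of_unit {m : Type*} [Fintype m] {X : Matrix m m ℂ} {B : ℝ}
    (h : ∀ ψ : m → ℂ, star ψ ⬝ᵥ ψ = 1 → |(star ψ ⬝ᵥ (X *ᵥ ψ)).re| ≤ B) (φ : m → ℂ) :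
    |(star φ ⬝ᵥ (X *ᵥ φ)).re| ≤ B * eucNorm φ ^ 2 := by
  rcases (eucNorm_nonneg φ).lt_or_eq with hpos | hzero
  · -- normalise
    set r : ℝ := eucNorm φ with hr
    set ψ : m → ℂ := ((r⁻¹ : ℝ) : ℂ) • φ with hψ
    have hφ : φ = (r : ℂ) • ψ := by
      rw [hψ, smul_smul, ← Complex.ofReal_mul, mul_inv_cancel₀ hpos.ne', Complex.ofReal_one, one_smul]
    have hψ1 : star ψ ⬝ᵥ ψ = 1 := by
      rw [hψ, star_smul, smul_dotProduct, dotProduct_smul, star_dotProduct_self_eq_eucNorm_sq, smul_eq_mul,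
        smul_eq_mul, Complex.star_def, Complex.conj_ofReal, ← hr, ← Complex.ofReal_mul, ← Complex.ofReal_mul]
      rw [show r⁻¹ * (r⁻¹ * r ^ 2) = (r⁻¹ * r) * (r⁻¹ * r) by ring, inv_mul_cancel₀ hpos.ne', one_mul,
        Complex.ofReal_one]
    have hq : (star φ ⬝ᵥ (X *ᵥ φ)).re = r ^ 2 * (star ψ ⬝ᵥ (X *ᵥ ψ)).re := by
      rw [hφ, mulVec_smul, star_smul, smul_dotProduct, dotProduct_smul, smul_eq_mul, smul_eq_mul,
        Complex.star_def, Complex.conj_ofReal, ← mul_assoc, ← Complex.ofReal_mul, ← sq, Complex.re_ofReal_mul]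
    rw [hq, abs_mul, abs_of_nonneg (sq_nonneg r), mul_comm]
    exact mul_le_mul_of_nonneg_right (h ψ hψ1) (sq_nonneg r)
  · have hφ0 : φ = 0 := by
      have h0 : star φ ⬝ᵥ φ = 0 := by
        rw [star_dotProduct_self_eq_eucNorm_sq, ← hzero]; simp
      exact dotProduct_star_self_eq_zero.1 h0
    subst hφ0
    simp

/-! ### §1  One torus: the tower step -/

section Finite

variable {L : ℕ} [NeZero L] (g : Site 2 → ℝ)

/-- **The finite-volume tower step.** On one torus of side `L`: a unit sector ground state `ψ` (sector
`(N, S^z = 0)`) of `H = hubbardTorusTT' L t t' U` with LRO floor `c₀ L⁴ ≤ Re⟨ψ, Δ†Δ ψ⟩` (`c₀ > 0`), the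
three constants `‖Δ†φ‖ ≤ C_αL²‖φ‖`, `‖(HΔ† − Δ†H)φ‖ ≤ C_κL²‖φ‖` (all `φ`), `|Re⟨φ, [Δ, Δ†] φ⟩| ≤ C_γL²`
(unit `φ`), a side large enough that `(k+1)C_γ ≤ (c₀/2)L²`, and a one-point variational bound (OP1) valid
for every unit vector, with `κ ≥ 0`, give
`(k/(k+1))·√(c₀ − (k+1)C_γ/L²) ≤ −(c − A + (Σ_σ μ_σ)((N/2)/L² − ν) + κ(u − E/L²)) + K/L²`,
`E = minEnergyOn (szSector N 0)`, `K = −(Σ_σ μ_σ)·k/2 + κ·(C_κ/√(c₀/2))·Σ_{i<k}(C_α/√(c₀/2))^i`.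
[cite: KomaTasaki1994, Theorem 5 and §4] -/
theorem tower_finite_step (t t' U : ℝ) {N : ℕ} {ψ : Fock (Orb (FermionTorus 2 L))}
    (hψ1 : star ψ ⬝ᵥ ψ = 1) (hgs : IsGroundStateInSector (hubbardTorusTT' L t t' U) N 0 ψ)
    {c A κ u ν c₀ Cα Cκ Cγ : ℝ} (μ : Fin 2 → ℝ) (hκ : 0 ≤ κ) (hc₀ : 0 < c₀) (hCα : 0 ≤ Cα) (hCκ : 0 ≤ Cκ)
    (hCγ : 0 ≤ Cγ) (k : ℕ)
    (hα : ∀ φ : Fock (Orb (FermionTorus 2 L)),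
      eucNorm ((pairField g L)ᴴ *ᵥ φ) ≤ Cα * (L : ℝ) ^ 2 * eucNorm φ)
    (hκ' : ∀ φ : Fock (Orb (FermionTorus 2 L)),
      eucNorm ((hubbardTorusTT' L t t' U * (pairField g L)ᴴ - (pairField g L)ᴴ * hubbardTorusTT' L t t' U) *ᵥ φ) ≤
        Cκ * (L : ℝ) ^ 2 * eucNorm φ)
    (hγ : ∀ φ : Fock (Orb (FermionTorus 2 L)), star φ ⬝ᵥ φ = 1 →
      |(expect (pairField g L * (pairField g L)ᴴ - (pairField g L)ᴴ * pairField g L) φ).re| ≤ Cγ * (L : ℝ) ^ 2)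
    (hlro : c₀ * (L : ℝ) ^ 4 ≤ (expect ((pairField g L)ᴴ * pairField g L) ψ).re)
    (hLbig : (k + 1) * Cγ ≤ (c₀ / 2) * (L : ℝ) ^ 2)
    (hbound : ∀ ζ : Fock (Orb (FermionTorus 2 L)), star ζ ⬝ᵥ ζ = 1 →
      c - A + ∑ σ : Fin 2, μ σ *
          ((star ζ ⬝ᵥ ((∑ y : FermionTorus 2 L, numberOp y σ) *ᵥ ζ)).re / (L : ℝ) ^ 2 - ν) +
        κ * (u - (star ζ ⬝ᵥ (hubbardTorusTT' L t t' U *ᵥ ζ)).re / (L : ℝ) ^ 2) ≤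
        -((expect (pairField g L) ζ).re / (L : ℝ) ^ 2)) :
    (k : ℝ) / (k + 1) * Real.sqrt (c₀ - (k + 1) * Cγ / (L : ℝ) ^ 2) ≤
      -(c - A + (∑ σ : Fin 2, μ σ) * (((N : ℝ) / 2) / (L : ℝ) ^ 2 - ν) +
          κ * (u - (hubbardTorusTT' L t t' U).minEnergyOn (szSector N 0) / (L : ℝ) ^ 2)) +
        (-(∑ σ : Fin 2, μ σ) * k / 2 +
          κ * ((Cκ / Real.sqrt (c₀ / 2)) * ∑ i ∈ Finset.range k, (Cα / Real.sqrt (c₀ / 2)) ^ i)) / (L : ℝ) ^ 2 := by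
  set H := hubbardTorusTT' L t t' U with hH
  set P := pairField g L with hP
  set E : ℝ := H.minEnergyOn (szSector N 0) with hE
  have hL : (0 : ℝ) < (L : ℝ) := Nat.cast_pos.2 (Nat.pos_of_ne_zero (NeZero.ne L))
  have hL2 : (0 : ℝ) < (L : ℝ) ^ 2 := by positivity
  have hHN : H * totalNumber = totalNumber * H := (hubbardTorusTT'_commute_totalNumber L t t' U).eq
  have hNA : (totalNumber : Matrix _ _ ℂ) * Pᴴ - Pᴴ * totalNumber = ((2 : ℝ) : ℂ) • Pᴴ := by
    have h := commutator_conjTranspose_of_commutator totalNumber_isHermitian (totalNumber_commutator_pairField g L)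
    rw [neg_neg] at h; exact h
  have hHψ : H *ᵥ ψ = (E : ℂ) • ψ := hgs.2.2
  have hNψ : (totalNumber : Matrix _ _ ℂ) *ᵥ ψ = ((N : ℝ) : ℂ) • ψ := by
    rw [totalNumber_mulVec_of_isNParticle ((mem_szSector_iff _ _ ψ).1 hgs.1).1]; push_cast; rfl
  set α : ℝ := Cα * (L : ℝ) ^ 2 with hαdef
  set κ₁ : ℝ := Cκ * (L : ℝ) ^ 2 with hκ₁def
  set β : ℝ := Cγ * (L : ℝ) ^ 2 with hβdef
  have hβ' : ∀ φ : Fock (Orb (FermionTorus 2 L)),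
      |(star φ ⬝ᵥ ((Pᴴ * Pᴴᴴ - Pᴴᴴ * Pᴴ) *ᵥ φ)).re| ≤ β * eucNorm φ ^ 2 := by
    intro φ
    rw [conjTranspose_conjTranspose]
    have hunit : ∀ ψ' : Fock (Orb (FermionTorus 2 L)), star ψ' ⬝ᵥ ψ' = 1 →
        |(star ψ' ⬝ᵥ ((Pᴴ * P - P * Pᴴ) *ᵥ ψ')).re| ≤ β := by
      intro ψ' h1
      have h := hγ ψ' h1
      have e : (Pᴴ * P - P * Pᴴ) = -(P * Pᴴ - Pᴴ * P) := by abel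
      rw [e, neg_mulVec, dotProduct_neg, Complex.neg_re, abs_neg]
      exact h
    exact abs_re_quadForm_le_of_unit hunit φ
  set ρ : ℝ := (L : ℝ) ^ 2 * Real.sqrt (c₀ - (k + 1) * Cγ / (L : ℝ) ^ 2) with hρdef
  have hinside : c₀ / 2 ≤ c₀ - (k + 1) * Cγ / (L : ℝ) ^ 2 := by
    have h1 : (k + 1) * Cγ / (L : ℝ) ^ 2 ≤ c₀ / 2 := by
      rw [div_le_iff₀ hL2]; exact hLbig
    linarith
  have hρpos : 0 < ρ := by
    have : 0 < Real.sqrt (c₀ - (k + 1) * Cγ / (L : ℝ) ^ 2) := Real.sqrt_pos.2 (by linarith)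
    positivity
  have hρ2 : ρ ^ 2 + k * β ≤ eucNorm (Pᴴ *ᵥ ψ) ^ 2 := by
    have e1 : eucNorm (Pᴴ *ᵥ ψ) ^ 2 = (expect (P * Pᴴ) ψ).re := by
      rw [eucNorm_sq, star_mulVec, conjTranspose_conjTranspose, ← dotProduct_mulVec, mulVec_mulVec]; rfl
    have e2 : ρ ^ 2 = c₀ * (L : ℝ) ^ 4 - (k + 1) * Cγ * (L : ℝ) ^ 2 := by
      rw [hρdef, mul_pow, Real.sq_sqrt (by linarith)]
      field_simp
    have h3 : (expect (Pᴴ * P) ψ).re - Cγ * (L : ℝ) ^ 2 ≤ (expect (P * Pᴴ) ψ).re := by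
      have h := (abs_le.1 (hγ ψ hψ1)).1
      have e : expect (P * Pᴴ - Pᴴ * P) ψ = expect (P * Pᴴ) ψ - expect (Pᴴ * P) ψ := by
        simp [Literature.MathematicalPhysics.QuantumLattice.expect, sub_mulVec, dotProduct_sub]
      rw [e, Complex.sub_re] at h
      linarith
    rw [e1, e2, hβdef]
    nlinarith [hlro, h3]
  obtain ⟨Ξ, hΞ1, -, hΞP, hΞH, hΞG⟩ := exists_towerWitness totalNumber_isHermitian hHN
    (by norm_num : (2 : ℝ) ≠ 0) hNA hψ1 hHψ hNψ (by positivity : 0 ≤ α) hα (by positivity : 0 ≤ κ₁) hκ'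
    (by positivity : 0 ≤ β) hβ' k hρpos hρ2
  rw [conjTranspose_conjTranspose] at hΞP
  have hΞN : ∀ σ : Fin 2, (star Ξ ⬝ᵥ ((∑ y : FermionTorus 2 L, numberOp y σ) *ᵥ Ξ)).re = (N : ℝ) / 2 + k / 2 := by
    intro σ
    have hGA : (∑ y : FermionTorus 2 L, numberOp y σ) * Pᴴ - Pᴴ * (∑ y : FermionTorus 2 L, numberOp y σ) =
        ((1 : ℝ) : ℂ) • Pᴴ := by
      have h := commutator_conjTranspose_of_commutator (spinNumber_isHermitian (L := L) σ)
        (spinNumber_commutator_pairField g σ)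
      rw [neg_neg] at h; exact h
    have hGψ := spinNumber_mulVec_of_mem_szSector σ hgs.1
    rw [hΞG _ 1 ((N : ℝ) / 2) hGA hGψ, Complex.ofReal_re]
    ring
  have hwin := hbound Ξ hΞ1
  simp_rw [hΞN] at hwin
  have hfill : ∑ σ : Fin 2, μ σ * (((N : ℝ) / 2 + k / 2) / (L : ℝ) ^ 2 - ν) =
      (∑ σ : Fin 2, μ σ) * (((N : ℝ) / 2) / (L : ℝ) ^ 2 - ν) + (∑ σ : Fin 2, μ σ) * (k / 2) / (L : ℝ) ^ 2 := by
    rw [Finset.sum_mul, Finset.sum_mul, Finset.sum_div, ← Finset.sum_add_distrib]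
    refine Finset.sum_congr rfl fun σ _ => ?_
    field_simp
    ring
  rw [hfill] at hwin
  set Dbar : ℝ := (Cκ / Real.sqrt (c₀ / 2)) * ∑ i ∈ Finset.range k, (Cα / Real.sqrt (c₀ / 2)) ^ i with hDbar
  have hsqrt_le : (L : ℝ) ^ 2 * Real.sqrt (c₀ / 2) ≤ ρ := by
    rw [hρdef]
    exact mul_le_mul_of_nonneg_left (Real.sqrt_le_sqrt hinside) hL2.le
  have hs0 : 0 < Real.sqrt (c₀ / 2) := Real.sqrt_pos.2 (by linarith)
  have hratio1 : κ₁ / ρ ≤ Cκ / Real.sqrt (c₀ / 2) := by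
    rw [hκ₁def, div_le_div_iff₀ hρpos hs0]
    calc Cκ * (L : ℝ) ^ 2 * Real.sqrt (c₀ / 2) = Cκ * ((L : ℝ) ^ 2 * Real.sqrt (c₀ / 2)) := by ring
      _ ≤ Cκ * ρ := mul_le_mul_of_nonneg_left hsqrt_le hCκ
  have hratio2 : α / ρ ≤ Cα / Real.sqrt (c₀ / 2) := by
    rw [hαdef, div_le_div_iff₀ hρpos hs0]
    calc Cα * (L : ℝ) ^ 2 * Real.sqrt (c₀ / 2) = Cα * ((L : ℝ) ^ 2 * Real.sqrt (c₀ / 2)) := by ring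
      _ ≤ Cα * ρ := mul_le_mul_of_nonneg_left hsqrt_le hCα
  have hD_le : (κ₁ / ρ) * ∑ i ∈ Finset.range k, (α / ρ) ^ i ≤ Dbar := by
    rw [hDbar]
    refine mul_le_mul hratio1 (Finset.sum_le_sum fun i _ => ?_) (Finset.sum_nonneg fun i _ => by positivity)
      (div_nonneg hCκ hs0.le)
    exact pow_le_pow_left₀ (by positivity) hratio2 i
  have heΞ : (star Ξ ⬝ᵥ (H *ᵥ Ξ)).re ≤ E + Dbar := hΞH.trans (by linarith)
  have hone : (k : ℝ) / (k + 1) * ρ ≤ (expect P Ξ).re := hΞP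
  have hρL : ρ / (L : ℝ) ^ 2 = Real.sqrt (c₀ - (k + 1) * Cγ / (L : ℝ) ^ 2) := by
    rw [hρdef]; field_simp
  have hen : κ * (u - E / (L : ℝ) ^ 2) - κ * Dbar / (L : ℝ) ^ 2 ≤
      κ * (u - (star Ξ ⬝ᵥ (H *ᵥ Ξ)).re / (L : ℝ) ^ 2) := by
    have h1 : (star Ξ ⬝ᵥ (H *ᵥ Ξ)).re / (L : ℝ) ^ 2 ≤ E / (L : ℝ) ^ 2 + Dbar / (L : ℝ) ^ 2 := by
      rw [← add_div]; exact div_le_div_of_nonneg_right heΞ hL2.le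
    have h2 := mul_le_mul_of_nonneg_left h1 hκ
    rw [mul_add] at h2
    have e : κ * Dbar / (L : ℝ) ^ 2 = κ * (Dbar / (L : ℝ) ^ 2) := by ring
    rw [e]
    linarith
  have hop : (k : ℝ) / (k + 1) * Real.sqrt (c₀ - (k + 1) * Cγ / (L : ℝ) ^ 2) ≤ (expect P Ξ).re / (L : ℝ) ^ 2 := by
    rw [← hρL, ← mul_div_assoc]
    exact div_le_div_of_nonneg_right hone hL2.le
  have e3 : (-(∑ σ : Fin 2, μ σ) * k / 2 + κ * Dbar) / (L : ℝ) ^ 2 =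
      -((∑ σ : Fin 2, μ σ) * (k / 2) / (L : ℝ) ^ 2) + κ * Dbar / (L : ℝ) ^ 2 := by
    field_simp
  rw [e3]
  linarith [hwin, hen, hop]

end Finite

/-! ### §2  Families of sector ground states: the sharp ceiling `liminf u_k ≤ M²` -/

section Family

variable (g : Site 2 → ℝ)

/-- **A certified one-point variational bound `M` is the ceiling `liminf u_k ≤ M²` (sharp Koma–Tasaki
constant), `t–t'` model.** Let `U ≥ 0`, `0 ≤ n < 2`, `κ ≥ 0`, `e(t, t', U, n) ≤ u`, and suppose (OP1)
`c − A + Σ_σ μ_σ(Re⟨ζ,N_σζ⟩/L² − ν) + κ(u − Re⟨ζ,H_Lζ⟩/L²) ≤ −Re⟨ζ,Δ_gζ⟩/L²` holds for every unit vector `ζ`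
of every torus of side `L ≥ L₁` (`H_L = hubbardTorusTT' L t t' U`). Then every family of unit
`(rectN n L, S^z = 0)`-sector ground states has `liminf_k u_k ≤ (c − A + (Σ_σ μ_σ)(n/2 − ν))² = M²`
(the two-sector reading `liminf_pairFieldLRO_le_of_onePoint_variational_bound_TT'` gives `2M²`).
Proof: for `liminf u > c₀ > M²` pick the tower height `k` with `(k/(k+1))√c₀ > M`, read (OP1) in the tower
witness of `tower_finite_step` on every large even torus, and let `L → ∞`.
[cite: KomaTasaki1994, Theorem 5] [cite: WangEtAl2024, §III] [cite: Scalapino1995, §2 eq. (2.4)] -/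
theorem liminf_pairFieldLRO_le_sq_of_onePoint_variational_bound_TT' (t t' : ℝ) {U n : ℝ} (hU : 0 ≤ U)
    (hn0 : 0 ≤ n) (hn2 : n < 2) {c A κ u ν : ℝ} (μ : Fin 2 → ℝ) (hκ : 0 ≤ κ)
    (hu : energyDensityTT' t t' U n ≤ u) (L₁ : ℕ)
    (hbound : ∀ (L : ℕ) [NeZero L], L₁ ≤ L → ∀ ζ : Fock (Orb (FermionTorus 2 L)), star ζ ⬝ᵥ ζ = 1 →
      c - A + ∑ σ : Fin 2, μ σ *
          ((star ζ ⬝ᵥ ((∑ y : FermionTorus 2 L, numberOp y σ) *ᵥ ζ)).re / (L : ℝ) ^ 2 - ν) +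
        κ * (u - (star ζ ⬝ᵥ (hubbardTorusTT' L t t' U *ᵥ ζ)).re / (L : ℝ) ^ 2) ≤
        -((expect (pairField g L) ζ).re / (L : ℝ) ^ 2))
    (ψ : ∀ L, Fock (Orb (FermionTorus 2 L)))
    (hψ : ∀ L, IsGroundStateInSector (hubbardTorusTT' L t t' U) (rectN n L) 0 (ψ L))
    (hψ1 : ∀ L, star (ψ L) ⬝ᵥ ψ L = 1) :
    liminf (fun k : ℕ => (∑ x ∈ halfOpenBox 2 (2 * k), ∑ y ∈ halfOpenBox 2 (2 * k),
        torusPullback (pairFieldCorr g ψ) (2 * k) x y) / ((#(halfOpenBox 2 (2 * k)) : ℝ)) ^ 2) atTop ≤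
      (c - A + (∑ σ : Fin 2, μ σ) * (n / 2 - ν)) ^ 2 := by
  obtain ⟨Cγ, Lγ, hCγ, hγ⟩ := exists_abs_re_expect_commutator_pairField_le g
  obtain ⟨Cα, Lα, hCα, hα⟩ := exists_eucNorm_pairField_conjTranspose_mulVec_le g
  obtain ⟨Cκ, Lκ, hCκ, hκ'⟩ := exists_eucNorm_commutator_hubbardTorusTT'_pairField_conjTranspose_mulVec_le g t t' U
  set M : ℝ := -(c - A + (∑ σ : Fin 2, μ σ) * (n / 2 - ν)) with hM
  have hM2 : (c - A + (∑ σ : Fin 2, μ σ) * (n / 2 - ν)) ^ 2 = M ^ 2 := by rw [hM, neg_sq]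
  rw [hM2]
  set useq : ℕ → ℝ := fun k => (∑ x ∈ halfOpenBox 2 (2 * k), ∑ y ∈ halfOpenBox 2 (2 * k),
      torusPullback (pairFieldCorr g ψ) (2 * k) x y) / ((#(halfOpenBox 2 (2 * k)) : ℝ)) ^ 2 with huseq
  change liminf useq atTop ≤ M ^ 2
  set vseq : ℕ → ℝ := fun m =>
    (expect ((pairField g (m + 1))ᴴ * pairField g (m + 1)) (ψ (m + 1))).re / (((m + 1 : ℕ) : ℝ)) ^ 4
    with hvseq
  have hterm : ∀ k : ℕ, 1 ≤ k → ∃ m : ℕ, 2 * k = m + 1 ∧ useq k = vseq m := by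
    intro k hk
    obtain ⟨m, hm⟩ : ∃ m, 2 * k = m + 1 := ⟨2 * k - 1, by omega⟩
    refine ⟨m, hm, ?_⟩
    simp only [huseq, hvseq]
    rw [hm, torusLROSeq_pairFieldCorr_succ]
  have hvnonneg : ∀ m : ℕ, 0 ≤ vseq m := fun m => by
    simp only [hvseq]
    refine div_nonneg ?_ (by positivity)
    exact (Complex.nonneg_iff.1
      ((Matrix.posSemidef_conjTranspose_mul_self (pairField g (m + 1))).dotProduct_mulVec_nonneg
        (ψ (m + 1)))).1
  have hnonneg : ∀ k : ℕ, 1 ≤ k → 0 ≤ useq k := fun k hk => by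
    obtain ⟨m, -, heq⟩ := hterm k hk
    rw [heq]
    exact hvnonneg m
  have hbdd : IsBoundedUnder (· ≥ ·) atTop useq :=
    isBoundedUnder_of_eventually_ge (a := 0) (Filter.eventually_atTop.2 ⟨1, fun k hk => hnonneg k hk⟩)
  by_contra hcon
  rw [not_le] at hcon
  obtain ⟨c₀, hc₀M, hc₀lim⟩ := exists_between hcon
  have hc₀ : 0 < c₀ := lt_of_le_of_lt (sq_nonneg M) hc₀M
  have hev : ∀ᶠ k : ℕ in atTop, c₀ < useq k := eventually_lt_of_lt_liminf hc₀lim hbdd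
  -- the tower height: `(kt/(kt+1))·√c₀ > M`
  have hsqrt_pos : 0 < Real.sqrt c₀ := Real.sqrt_pos.2 hc₀
  have hMlt : M < Real.sqrt c₀ := by
    have h1 : |M| < Real.sqrt c₀ := by
      rw [← Real.sqrt_sq_eq_abs]; exact Real.sqrt_lt_sqrt (sq_nonneg M) hc₀M
    exact lt_of_le_of_lt (le_abs_self M) h1
  obtain ⟨kt, hkt⟩ : ∃ kt : ℕ, M < (kt : ℝ) / (kt + 1) * Real.sqrt c₀ := by
    set δ : ℝ := 1 - M / Real.sqrt c₀ with hδ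
    have hδpos : 0 < δ := by
      rw [hδ, sub_pos, div_lt_one hsqrt_pos]; exact hMlt
    obtain ⟨kt, hkt⟩ := exists_nat_gt (1 / δ)
    refine ⟨kt, ?_⟩
    have hk1 : (0 : ℝ) < kt + 1 := by positivity
    have h1 : 1 / ((kt : ℝ) + 1) < δ := by
      rw [div_lt_iff₀ hk1]
      have : 1 / δ * δ = 1 := by field_simp
      nlinarith [hkt, hδpos]
    have h2 : (kt : ℝ) / (kt + 1) = 1 - 1 / (kt + 1) := by field_simp; ring
    rw [h2]
    have h3 : M / Real.sqrt c₀ < 1 - 1 / ((kt : ℝ) + 1) := by rw [hδ] at h1; linarith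
    have := (div_lt_iff₀ hsqrt_pos).1 h3
    linarith
  set Dbar : ℝ := (Cκ / Real.sqrt (c₀ / 2)) * ∑ i ∈ Finset.range kt, (Cα / Real.sqrt (c₀ / 2)) ^ i with hDbar
  set K : ℝ := -(∑ σ : Fin 2, μ σ) * kt / 2 + κ * Dbar with hK
  obtain ⟨L₂, hL₂⟩ : ∃ L₂ : ℕ, ∀ L : ℕ, L₂ ≤ L → ((kt : ℝ) + 1) * Cγ ≤ (c₀ / 2) * (L : ℝ) ^ 2 := by
    obtain ⟨L₂, hL₂⟩ := exists_nat_ge (((kt : ℝ) + 1) * Cγ / (c₀ / 2))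
    refine ⟨max L₂ 1, fun L hL => ?_⟩
    have hL1 : (1 : ℝ) ≤ L := by exact_mod_cast le_trans (le_max_right _ _) hL
    have hLL : (L₂ : ℝ) ≤ L := by exact_mod_cast le_trans (le_max_left _ _) hL
    have hc2 : 0 < c₀ / 2 := by linarith
    have h1 : ((kt : ℝ) + 1) * Cγ ≤ (c₀ / 2) * L := by
      rw [div_le_iff₀ hc2] at hL₂; nlinarith
    have h2 : (c₀ / 2) * (L : ℝ) ≤ (c₀ / 2) * (L : ℝ) ^ 2 := by
      have : (L : ℝ) ≤ (L : ℝ) ^ 2 := by nlinarith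
      exact mul_le_mul_of_nonneg_left this hc2.le
    linarith
  set Lr : ℕ → ℝ := fun k => ((2 * k : ℕ) : ℝ) with hLr
  set Eseq : ℕ → ℝ := fun k =>
    groundEnergy (hubbardTorusTT' (2 * k) t t' U) (rectN n (2 * k)) / ((2 * k : ℕ) : ℝ) ^ 2 with hEseq
  set Nseq : ℕ → ℝ := fun k => (rectN n (2 * k) : ℝ) / ((2 * k : ℕ) : ℝ) ^ 2 with hNseq
  set lhs : ℕ → ℝ := fun k => (kt : ℝ) / (kt + 1) * Real.sqrt (c₀ - (kt + 1) * Cγ / Lr k ^ 2) with hlhs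
  set rhs : ℕ → ℝ := fun k =>
    -(c - A + (∑ σ : Fin 2, μ σ) * (Nseq k / 2 - ν) + κ * (u - Eseq k)) + K / Lr k ^ 2 with hrhs
  -- the finite-volume tower step, eventually in `k`
  have hstep : ∀ᶠ k : ℕ in atTop, lhs k ≤ rhs k := by
    filter_upwards [hev, Filter.eventually_ge_atTop (max 1 (max L₁ (max Lγ (max Lα (max Lκ L₂)))))]
      with k hk hkL
    have hk1 : 1 ≤ k := le_trans (le_max_left _ _) hkL
    obtain ⟨m, hm, heq⟩ := hterm k hk1
    simp only [max_le_iff] at hkL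
    obtain ⟨-, hkL₁, hkγ, hkα, hkκ, hk₂⟩ := hkL
    have hmL₁ : L₁ ≤ m + 1 := by omega
    have hmγ : Lγ ≤ m + 1 := by omega
    have hmα : Lα ≤ m + 1 := by omega
    have hmκ : Lκ ≤ m + 1 := by omega
    have hm₂ : L₂ ≤ m + 1 := by omega
    have hlro : c₀ * (((m + 1 : ℕ) : ℝ)) ^ 4 ≤
        (expect ((pairField g (m + 1))ᴴ * pairField g (m + 1)) (ψ (m + 1))).re := by
      have h := hk.le
      rw [heq] at h
      simp only [hvseq] at h
      rwa [le_div_iff₀ (by positivity)] at h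
    have h := tower_finite_step g t t' U (hψ1 (m + 1)) (hψ (m + 1)) μ hκ hc₀ hCα hCκ hCγ kt
      (hα (m + 1) hmα) (hκ' (m + 1) hmκ) (hγ (m + 1) hmγ) hlro (hL₂ (m + 1) hm₂) (hbound (m + 1) hmL₁)
    have hcard : ⌊n * (((m + 1 : ℕ)) : ℝ) ^ 2 / 2⌋₊ ≤ Fintype.card (FermionTorus 2 (m + 1)) := by
      rw [show Fintype.card (FermionTorus 2 (m + 1)) = (m + 1) ^ 2 by simp]
      have h2 := rectN_le_two_mul hn0 hn2.le (m + 1)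
      simp only [rectN] at h2
      have e : (m + 1) ^ 2 = (m + 1) * (m + 1) := by ring
      rw [e]
      exact Nat.le_of_mul_le_mul_left h2 (by norm_num)
    have hE : (hubbardTorusTT' (m + 1) t t' U).minEnergyOn (szSector (rectN n (m + 1)) 0) =
        groundEnergy (hubbardTorusTT' (m + 1) t t' U) (rectN n (m + 1)) := by
      simp only [rectN]
      rw [groundEnergy_hubbardTorusTT'_eq_minEnergyOn_szSector (m + 1) t t' U hcard]
    rw [hE, ← hDbar, ← hK] at h
    have e1 : ((rectN n (m + 1) : ℕ) : ℝ) / 2 / (((m + 1 : ℕ) : ℝ)) ^ 2 =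
        ((rectN n (m + 1) : ℕ) : ℝ) / (((m + 1 : ℕ) : ℝ)) ^ 2 / 2 := div_right_comm _ _ _
    rw [e1] at h
    simp only [hlhs, hrhs, hLr, hNseq, hEseq]
    rw [hm]
    exact h
  have h2k : Tendsto (fun k : ℕ => 2 * k) atTop atTop := Filter.tendsto_id.const_mul_atTop' (by norm_num)
  have hLr_top : Tendsto Lr atTop atTop := tendsto_natCast_atTop_atTop.comp h2k
  have hLr2 : Tendsto (fun k => (Lr k ^ 2)⁻¹) atTop (𝓝 0) :=
    ((tendsto_pow_atTop (α := ℝ) two_ne_zero).comp hLr_top).inv_tendsto_atTop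
  have hlhs_lim : Tendsto lhs atTop (𝓝 ((kt : ℝ) / (kt + 1) * Real.sqrt c₀)) := by
    have h1 : Tendsto (fun k => c₀ - (kt + 1) * Cγ * (Lr k ^ 2)⁻¹) atTop (𝓝 (c₀ - (kt + 1) * Cγ * 0)) :=
      tendsto_const_nhds.sub (hLr2.const_mul _)
    rw [mul_zero, sub_zero] at h1
    have h2 := (h1.sqrt).const_mul ((kt : ℝ) / (kt + 1))
    refine h2.congr' (Eventually.of_forall fun k => ?_)
    simp [hlhs, div_eq_mul_inv, mul_assoc]
  have hE_lim : Tendsto Eseq atTop (𝓝 (energyDensityTT' t t' U n)) :=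
    (tendsto_energyDensityTT'_torus t t' hU hn0 hn2).comp h2k
  have hN_lim : Tendsto Nseq atTop (𝓝 n) := (tendsto_rectN_div_sq hn0).comp h2k
  have hrhs_lim : Tendsto rhs atTop
      (𝓝 (-(c - A + (∑ σ : Fin 2, μ σ) * (n / 2 - ν) + κ * (u - energyDensityTT' t t' U n)) + K * 0)) := by
    have h1 : Tendsto (fun k => -(c - A + (∑ σ : Fin 2, μ σ) * (Nseq k / 2 - ν) + κ * (u - Eseq k)))
        atTop (𝓝 (-(c - A + (∑ σ : Fin 2, μ σ) * (n / 2 - ν) + κ * (u - energyDensityTT' t t' U n)))) :=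
      ((tendsto_const_nhds.add (((hN_lim.div_const 2).sub tendsto_const_nhds).const_mul _)).add
        ((tendsto_const_nhds.sub hE_lim).const_mul κ)).neg
    have h2 := h1.add (hLr2.const_mul K)
    refine h2.congr' (Eventually.of_forall fun k => ?_)
    simp [hrhs, div_eq_mul_inv]
  have hle := le_of_tendsto_of_tendsto hlhs_lim hrhs_lim hstep
  rw [mul_zero, add_zero] at hle
  have hslack : 0 ≤ κ * (u - energyDensityTT' t t' U n) := mul_nonneg hκ (sub_nonneg.2 hu)
  have : (kt : ℝ) / (kt + 1) * Real.sqrt c₀ ≤ M := by linarith [hM, hle, hslack]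
  linarith

end Family

end Summit.Ventures.CertifiedManyBodySolver.Observables

end
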